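import Mathlib.NumberTheory.EulerProduct.DirichletLSeries
import Literature.NumberTheory.LFunctions.ZetaEulerProductMeanSquareUniformProofs
import Literature.NumberTheory.LFunctions.DirichletLFunctionIteratedAbel
import HarnessLib

/-!
# Finite Euler products approximate `L(s, χ)` in mean square (non-principal `χ`)

Topic `Literature/NumberTheory/LFunctions` (namespace `Literature.NumberTheory.LFunctions`,
grouping sub-namespace `CharEulerProductMeanSquare`). Everything in this file is PROVED. It is the
analogue for Dirichlet `L`-functions of the tree's
`Literature.NumberTheory.LFunctions.zeta_sub_finiteEulerProduct_meanSquare_le` /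
`EulerProductMeanSquareUniform.zeta_sub_finiteEulerProduct_meanSquare_le_uniform` (Bohr's
mean-square approximation of `ζ` by finite Euler products, Titchmarsh §11.9 first display), the
mean-square input of the (hybrid) joint universality theorem for Dirichlet `L`-functions
(Pańkowski 2010, class `E` property (4) and the term `S₂` of Lemma 3.1; Karatsuba–Voronin
Ch. VII; Steuding Thm. 4.11):

* `CharEulerProductMeanSquare.LFunction_sub_finiteEulerProduct_meanSquare_le_uniform` — for
  `χ ≠ χ₀` mod `q`, `1/2 < σ₁ ≤ σ₂` and `ε > 0` there is `P₀` such that for every `P ≥ P₀` there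
  is `T₀` with `∫_{−T}^{T} |L(σ+it, χ) − ∏_{p<P}(1 − χ(p)p^{−σ−it})⁻¹|² dt ≤ ε T` for all
  `T ≥ T₀` and all `σ ∈ [σ₁, σ₂]`.

Proof: exactly the tree's proof for `ζ` — for `Re s > 0` the twisted finite Euler product is the
absolutely convergent sum of `χ(n) n^{−s}` over the `P`-smooth numbers
(`hasSum_indicator_smoothNumbers_char_cpow`, Mathlib's
`EulerProduct.summable_and_hasSum_smoothNumbers_prod_primesBelow_geometric` for
`dirichletSummandHom χ`); `L(s, χ)` is the Dirichlet polynomial `Σ_{n ≤ M} χ(n) n^{−s}`,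
`M = ⌈T^a⌉`, `1 < a < 1/(2−2σ₁)`, up to `O(T^{−aσ₁} + T^{−e₀})` uniformly for `|t| ≤ T`,
`σ ∈ [σ₁, σ₂]` — here by ITERATED ABEL SUMMATION of order `k > a/(a−1)`
(`IteratedAbel.norm_LFunction_sub_sum_le_iterated`, the periodic-coefficient substitute for
the Euler–Maclaurin formula used for `ζ`; no pole term); the difference is the Dirichlet
polynomial over the non-smooth `n ≤ M` (all `≥ P`) plus small errors, and the sharp mean value
theorem (`DirichletMVT.meanSquare_le_sharp`) bounds its mean square by
`5T Σ_{n≥P} n^{−2σ₁} + O(M^{2−2σ₁+})`, `M^{2−2σ₁+} = o(T)`.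

## References

* [Titchmarsh1986] E. C. Titchmarsh, *The Theory of the Riemann Zeta-Function*, 2nd ed.,
  §11.9 (first display; the method, for `ζ`) and §9.17.
* [Steuding2007] J. Steuding, *Value-Distribution of L-Functions*, LNM 1877, Springer 2007,
  Thm. 1.10 and §4 (mean-square half-plane of `L(s, χ)`, Thm. 4.11).
* [Pankowski2010] Ł. Pańkowski, *Hybrid joint universality theorem for Dirichlet L-functions*,
  Acta Arith. 141 (2010), 59–72, §2 (class `E`, property (4)), proof of Lemma 3.1 (`S₂`).
-/

noncomputable section

open Complex Filter Topology MeasureTheory Set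

namespace Literature.NumberTheory.LFunctions

namespace CharEulerProductMeanSquare

open EulerProductMeanSquare EulerProductMeanSquareUniform IteratedAbel

variable {q : ℕ} (χ : DirichletCharacter ℂ q)

/-! ### The twisted finite Euler product as a sum over smooth numbers -/

/-- For a prime `p` and `Re s > 0`: `p^{-Re s} < 1`. [folklore] -/
theorem rpow_neg_re_lt_one {p : ℕ} (hp : p.Prime) {s : ℂ} (hs : 0 < s.re) :
    (p : ℝ) ^ (-s.re) < 1 :=
  Real.rpow_lt_one_of_one_lt_of_neg (by exact_mod_cast hp.one_lt) (by linarith)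

/-- `‖χ(n) n^{-s}‖ ≤ n^{-Re s}` for `n ≥ 1`. [folklore] -/
theorem norm_char_mul_cpow_le {n : ℕ} (hn : 0 < n) (s : ℂ) :
    ‖χ n * (n : ℂ) ^ (-s)‖ ≤ (n : ℝ) ^ (-s.re) := by
  rw [norm_mul, PartialEuler.norm_natCast_cpow_neg hn]
  calc ‖χ n‖ * (n : ℝ) ^ (-s.re) ≤ 1 * (n : ℝ) ^ (-s.re) := by
        gcongr; exact χ.norm_le_one _
    _ = (n : ℝ) ^ (-s.re) := one_mul _

/-- **The twisted finite Euler product is the smooth `L`-sum** (`Re s > 0`):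
`∏_{p<P} (1 - χ(p) p^{-s})⁻¹ = Σ_{n P-smooth} χ(n) n^{-s}`, absolutely convergent (Mathlib's
`EulerProduct.summable_and_hasSum_smoothNumbers_prod_primesBelow_geometric` for
`dirichletSummandHom χ`). [folklore] -/
theorem hasSum_indicator_smoothNumbers_char_cpow {s : ℂ} (hs : 0 < s.re) (P : ℕ) :
    HasSum ((P.smoothNumbers).indicator fun n : ℕ ↦ χ n * (n : ℂ) ^ (-s))
      (∏ p ∈ P.primesBelow, (1 - χ p * (p : ℂ) ^ (-s))⁻¹) := by
  have hs0 : s ≠ 0 := fun h ↦ by rw [h] at hs; simp at hs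
  have h := EulerProduct.summable_and_hasSum_smoothNumbers_prod_primesBelow_geometric
    (f := (dirichletSummandHom χ hs0 : ℕ →* ℂ)) (fun {p} hp ↦ ?_) P
  · have e : (⇑(dirichletSummandHom χ hs0 : ℕ →* ℂ)) =
        fun n : ℕ ↦ χ n * (n : ℂ) ^ (-s) := by
      funext n; rfl
    have h2 := hasSum_subtype_iff_indicator.1 h.2
    rw [e] at h2
    convert h2 using 2
  · change ‖χ p * (p : ℂ) ^ (-s)‖ < 1
    exact (norm_char_mul_cpow_le χ hp.pos s).trans_lt (rpow_neg_re_lt_one hp hs)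

/-- **Smooth tail**, twisted: for `Re s = σ > 0` and every `L`,
`‖∏_{p<P}(1 - χ(p)p^{-s})⁻¹ - Σ_{n<L} 1_{smooth}(n) χ(n) n^{-s}‖ ≤ Σ_{k≥0} 1_{smooth}(k+L) (k+L)^{-σ}`.
[folklore] -/
theorem norm_charEulerProduct_sub_sum_le {s : ℂ} (hs : 0 < s.re) (P L : ℕ) :
    ‖∏ p ∈ P.primesBelow, (1 - χ p * (p : ℂ) ^ (-s))⁻¹ -
        ∑ n ∈ Finset.range L, (P.smoothNumbers).indicator (fun n : ℕ ↦ χ n * (n : ℂ) ^ (-s)) n‖ ≤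
      ∑' k : ℕ, (P.smoothNumbers).indicator (fun n : ℕ ↦ (n : ℝ) ^ (-s.re)) (k + L) := by
  have hH := hasSum_indicator_smoothNumbers_char_cpow χ hs P
  have hS : Summable ((P.smoothNumbers).indicator fun n : ℕ ↦ χ n * (n : ℂ) ^ (-s)) := hH.summable
  rw [← hH.tsum_eq, ← hS.sum_add_tsum_nat_add L, add_sub_cancel_left]
  have hSR := summable_indicator_smoothNumbers_rpow hs P
  have hSR' : Summable fun k : ℕ ↦ (P.smoothNumbers).indicator (fun n : ℕ ↦ (n : ℝ) ^ (-s.re))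
      (k + L) := hSR.comp_injective (add_left_injective L)
  have hterm : ∀ k : ℕ, ‖(P.smoothNumbers).indicator (fun n : ℕ ↦ χ n * (n : ℂ) ^ (-s)) (k + L)‖ ≤
      (P.smoothNumbers).indicator (fun n : ℕ ↦ (n : ℝ) ^ (-s.re)) (k + L) := by
    intro k
    by_cases hmem : k + L ∈ P.smoothNumbers
    · rw [indicator_of_mem hmem, indicator_of_mem hmem]
      exact norm_char_mul_cpow_le χ (Nat.pos_of_ne_zero (Nat.ne_zero_of_mem_smoothNumbers hmem)) s
    · rw [indicator_of_notMem hmem, indicator_of_notMem hmem, norm_zero]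
  exact tsum_of_norm_bounded hSR'.hasSum hterm

/-! ### Small lemmas -/

/-- `‖x + y - z‖² ≤ 3 (‖x‖² + ‖y‖² + ‖z‖²)`. [folklore] -/
theorem norm_add_sub_sq_le (x y z : ℂ) :
    ‖x + y - z‖ ^ 2 ≤ 3 * (‖x‖ ^ 2 + ‖y‖ ^ 2 + ‖z‖ ^ 2) := by
  have h1 : ‖x + y - z‖ ≤ ‖x‖ + ‖y‖ + ‖z‖ := by
    calc ‖x + y - z‖ ≤ ‖x + y‖ + ‖z‖ := norm_sub_le _ _
      _ ≤ ‖x‖ + ‖y‖ + ‖z‖ := by gcongr; exact norm_add_le _ _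
  have h0 : 0 ≤ ‖x + y - z‖ := norm_nonneg _
  nlinarith [sq_nonneg (‖x‖ - ‖y‖), sq_nonneg (‖y‖ - ‖z‖), sq_nonneg (‖x‖ - ‖z‖),
    norm_nonneg x, norm_nonneg y, norm_nonneg z]

/-- Reindexing `Σ_{n<M} f(n+1) = Σ_{m=1}^{M} f(m)`. [folklore] -/
theorem sum_range_succ_eq_sum_Icc {β : Type*} [AddCommMonoid β] (f : ℕ → β) (M : ℕ) :
    ∑ n ∈ Finset.range M, f (n + 1) = ∑ m ∈ Finset.Icc 1 M, f m := by
  induction M with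
  | zero => simp
  | succ M ih => rw [Finset.sum_range_succ, ih, Finset.sum_Icc_succ_top (by omega)]

/-- The final bookkeeping, as a statement about real numbers. [folklore] -/
theorem bookkeeping {ε T κ X A τ Rb ρ : ℝ} (hT : 1 ≤ T) (hκ : 0 < κ) (hτ0 : 0 ≤ τ)
    (hτ : τ < ε / 40) (hA : A ≤ 2 * (X * T)) (hX : 390 / κ * X < ε / 8)
    (hR : 6 * Rb ^ 2 < ε / 8) (hρ : 6 * ρ ^ 2 < ε / 8) :
    3 * (5 * T * τ + 65 * (A / κ)) + (T - -T) * (3 * (Rb ^ 2 + ρ ^ 2)) ≤ ε * T := by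
  have hT0 : 0 < T := by linarith
  have h1 : 3 * (5 * T * τ) ≤ 3 / 8 * ε * T := by nlinarith
  have h2 : 3 * (65 * (A / κ)) ≤ ε / 8 * T := by
    have h2a : A / κ ≤ 2 * (X * T) / κ := div_le_div_of_nonneg_right hA hκ.le
    have h2b : 3 * (65 * (2 * (X * T) / κ)) = (390 / κ * X) * T := by field_simp; ring
    have h2c : (390 / κ * X) * T ≤ ε / 8 * T := mul_le_mul_of_nonneg_right hX.le hT0.le
    linarith
  have h3 : (T - -T) * (3 * (Rb ^ 2 + ρ ^ 2)) ≤ ε / 8 * T + ε / 8 * T := by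
    have : (T - -T) * (3 * (Rb ^ 2 + ρ ^ 2)) = T * (6 * Rb ^ 2) + T * (6 * ρ ^ 2) := by ring
    rw [this]
    nlinarith
  have hε0 : 0 < ε := by nlinarith [sq_nonneg Rb]
  nlinarith

/-! ### Continuity -/

/-- For `χ ≠ χ₀`, `t ↦ L(σ+it, χ) − ∏_{p<P}(1 − χ(p)p^{−σ−it})⁻¹` is continuous (`σ > 0`).
[folklore] -/
theorem continuous_LFunction_sub_eulerProduct [NeZero q] (hχ : χ ≠ 1) {σ : ℝ} (hσ : 0 < σ)
    (P : ℕ) :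
    Continuous fun t : ℝ ↦ χ.LFunction (σ + t * I) -
      ∏ p ∈ P.primesBelow, (1 - χ p * (p : ℂ) ^ (-(σ + t * I : ℂ)))⁻¹ := by
  have hmap : Continuous fun t : ℝ ↦ (σ : ℂ) + t * I := by fun_prop
  refine ((DirichletCharacter.differentiable_LFunction hχ).continuous.comp hmap).sub ?_
  refine continuous_finsetProd _ fun p hp ↦ ?_
  have hpp : p.Prime := Nat.prime_of_mem_primesBelow hp
  have hp0 : (p : ℂ) ≠ 0 := by exact_mod_cast hpp.ne_zero
  have hc : Continuous fun t : ℝ ↦ (1 : ℂ) - χ p * (p : ℂ) ^ (-(σ + t * I : ℂ)) :=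
    continuous_const.sub (continuous_const.mul ((hmap.neg).const_cpow (Or.inl hp0)))
  refine hc.inv₀ fun t h ↦ ?_
  have hlt : ‖χ p * (p : ℂ) ^ (-(σ + t * I : ℂ))‖ < 1 :=
    (norm_char_mul_cpow_le χ hpp.pos _).trans_lt
      (rpow_neg_re_lt_one hpp (show 0 < ((σ : ℂ) + t * I).re by simp [hσ]))
  rw [sub_eq_zero] at h
  rw [← h, norm_one] at hlt
  exact lt_irrefl _ hlt

/-! ### The mean-square theorem -/

/-- **Finite Euler products approximate `L(s, χ)` in mean square, `χ` non-principal, uniformly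
for `σ` in a compact part of `σ > 1/2`.** For `χ ≠ χ₀` mod `q`, `1/2 < σ₁ ≤ σ₂` and `ε > 0`
there is `P₀` such that for every `P ≥ P₀` there is `T₀` with
`∫_{−T}^{T} |L(σ+it, χ) − ∏_{p<P}(1 − χ(p)p^{−σ−it})⁻¹|² dt ≤ ε T` for all `T ≥ T₀` and all
`σ ∈ [σ₁, σ₂]`. Proof as for `ζ` in the tree (`zeta_sub_finiteEulerProduct_meanSquare_le`:
smooth-number form of the finite Euler product, the sharp mean value theorem for Dirichlet
polynomials `DirichletMVT.meanSquare_le_sharp`), with the Euler–Maclaurin formula replaced by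
iterated Abel summation (`IteratedAbel.norm_LFunction_sub_sum_le_iterated`, order
`k > a/(a−1)`, length `N ≈ T^a`), and no pole. (Bohr–Landau; Titchmarsh §11.9 for `ζ`; for
`L(s, χ)` e.g. Karatsuba–Voronin Ch. VII §1 / Steuding Thm. 4.11 via Carlson's theorem.)
[cite: Titchmarsh1986, §11.9 (first display) and §9.17] [cite: Steuding2007, Thm. 1.10 (proof)] -/
theorem LFunction_sub_finiteEulerProduct_meanSquare_le_uniform [NeZero q] (hχ : χ ≠ 1) {σ₁ σ₂ : ℝ}
    (hσ₁ : 1 / 2 < σ₁) (hσ₁₂ : σ₁ ≤ σ₂) {ε : ℝ} (hε : 0 < ε) :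
    ∃ P₀ : ℕ, ∀ P : ℕ, P₀ ≤ P → ∃ T₀ : ℝ, ∀ T : ℝ, T₀ ≤ T → ∀ σ : ℝ, σ₁ ≤ σ → σ ≤ σ₂ →
      ∫ t in (-T : ℝ)..T, ‖χ.LFunction (σ + t * I) -
          ∏ p ∈ P.primesBelow, (1 - χ p * (p : ℂ) ^ (-(σ + t * I : ℂ)))⁻¹‖ ^ 2 ≤ ε * T := by
  have hσ₁0 : 0 < σ₁ := by linarith
  have hq : 0 < q := Nat.pos_of_ne_zero (NeZero.ne q)
  have hq1 : (1 : ℝ) ≤ q := by exact_mod_cast hq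
  -- exponents `2 - 2σ₁ ≤ κ₀ < κ < 1/a`, `1 < a ≤ 2`, and the Abel order `k`
  obtain ⟨κ₀, hκ₀, hκ₀0, hκ₀1⟩ : ∃ κ₀ : ℝ, 2 - 2 * σ₁ ≤ κ₀ ∧ 0 ≤ κ₀ ∧ κ₀ < 1 :=
    ⟨max (2 - 2 * σ₁) 0, le_max_left _ _, le_max_right _ _, max_lt (by linarith) one_pos⟩
  obtain ⟨a, ha1, ha2, haκ₀⟩ : ∃ a : ℝ, 1 < a ∧ a ≤ 2 ∧ a * κ₀ < 1 := by
    refine ⟨2 / (1 + κ₀), ?_, ?_, ?_⟩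
    · rw [lt_div_iff₀ (by linarith)]; linarith
    · rw [div_le_iff₀ (by linarith)]; linarith
    · rw [div_mul_eq_mul_div, div_lt_one (by linarith)]; linarith
  have ha0 : 0 < a := by linarith
  obtain ⟨κ, hκ0, hκ₀κ, hκ1, haκ⟩ : ∃ κ : ℝ, 0 < κ ∧ κ₀ ≤ κ ∧ κ ≤ 1 ∧ a * κ < 1 := by
    have h1a : 0 < 1 / a := by positivity
    have h1a1 : 1 / a < 1 := by rw [div_lt_one ha0]; exact ha1
    have hκ₀a : κ₀ < 1 / a := by rw [lt_div_iff₀ ha0]; linarith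
    refine ⟨(κ₀ + 1 / a) / 2, by linarith, by linarith, by linarith, ?_⟩
    have : a * ((κ₀ + 1 / a) / 2) = (a * κ₀ + 1) / 2 := by field_simp
    rw [this]; linarith
  -- the Abel order `k` with `k (a - 1) > a`, and the resulting decay exponent `e₀ > 0`
  obtain ⟨k, hk1, hka⟩ : ∃ k : ℕ, 1 ≤ k ∧ a < k * (a - 1) := by
    refine ⟨⌈a / (a - 1)⌉₊ + 1, by omega, ?_⟩
    have h1 : a / (a - 1) < ((⌈a / (a - 1)⌉₊ + 1 : ℕ) : ℝ) := by
      push_cast; exact lt_of_le_of_lt (Nat.le_ceil _) (by linarith)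
    rw [div_lt_iff₀ (by linarith)] at h1
    linarith
  set e₀ : ℝ := k * (a - 1) - a * (1 - σ₁) with he₀
  have he₀0 : 0 < e₀ := by
    rw [he₀]
    have : a * (1 - σ₁) < a := by nlinarith
    linarith
  have hk1r : (1 : ℝ) ≤ k := by exact_mod_cast hk1
  -- the constant of the iterated Abel bound
  set C : ℝ := 2 * q * (6 * q) ^ k with hC
  have hC0 : 0 ≤ C := by positivity
  -- the tail `τ(P)` at `σ₁` and the choice of `P₀`
  obtain ⟨P₀, hP₀⟩ := eventually_atTop.1
    ((tendsto_tsum_rpow_tail (σ := σ₁)).eventually_lt_const (show (0 : ℝ) < ε / 40 by positivity))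
  refine ⟨P₀, fun P hP ↦ ?_⟩
  have hτ : ∑' n : ℕ, ((n + P : ℕ) : ℝ) ^ (-(2 * σ₁)) < ε / 40 := hP₀ P hP
  have hτ0 : 0 ≤ ∑' n : ℕ, ((n + P : ℕ) : ℝ) ^ (-(2 * σ₁)) := tsum_nonneg fun n ↦ by positivity
  -- the smooth tail `ρ(L)` at `σ₁`
  obtain ⟨ρ, hρlim, hρbd⟩ : ∃ ρ : ℕ → ℝ, Tendsto ρ atTop (𝓝 0) ∧ ∀ (L : ℕ) (σ t : ℝ), σ₁ ≤ σ →
      ‖∏ p ∈ P.primesBelow, (1 - χ p * (p : ℂ) ^ (-(σ + t * I : ℂ)))⁻¹ -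
        ∑ n ∈ Finset.range L, (P.smoothNumbers).indicator
          (fun n : ℕ ↦ χ n * (n : ℂ) ^ (-(σ + t * I : ℂ))) n‖ ≤ ρ L := by
    refine ⟨fun L ↦ ∑' n : ℕ, (P.smoothNumbers).indicator (fun n : ℕ ↦ (n : ℝ) ^ (-σ₁)) (n + L),
      tendsto_sum_nat_add _, fun L σ t hσ ↦ ?_⟩
    have hs : 0 < (σ + t * I : ℂ).re := by simp; linarith
    have h := norm_charEulerProduct_sub_sum_le χ hs P L
    have hre : (σ + t * I : ℂ).re = σ := by simp
    rw [hre] at h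
    exact h.trans (tsum_indicator_smooth_mono hσ₁0 hσ P L)
  have hρ0 : ∀ L : ℕ, 0 ≤ ρ L := fun L ↦ (norm_nonneg _).trans (hρbd L σ₁ 0 le_rfl)
  -- the choice of `T₀`
  have hMlim : Tendsto (fun T : ℝ ↦ ⌈T ^ a⌉₊ + 1) atTop atTop :=
    (tendsto_add_atTop_nat 1).comp (tendsto_nat_ceil_atTop.comp (tendsto_rpow_atTop ha0))
  have eρ : ∀ᶠ T : ℝ in atTop, 6 * ρ (⌈T ^ a⌉₊ + 1) ^ 2 < ε / 8 := by
    have h := ((hρlim.comp hMlim).pow 2).const_mul 6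
    rw [zero_pow two_ne_zero, mul_zero] at h
    exact h.eventually_lt_const (by positivity)
  have eκ : ∀ᶠ T : ℝ in atTop, 390 / κ * T ^ (-(1 - a * κ)) < ε / 8 := by
    have h := (tendsto_rpow_neg_atTop (show 0 < 1 - a * κ by linarith)).const_mul (390 / κ)
    rw [mul_zero] at h
    exact h.eventually_lt_const (by positivity)
  -- the Abel remainder bound `Rb(T) = C (T^{-aσ₁} + 3^k T^{-e₀}/(σ₁+k-1))` tends to `0`
  have eR : ∀ᶠ T : ℝ in atTop,
      6 * (C * (T ^ (-(a * σ₁)) + (3 : ℝ) ^ k * T ^ (-e₀) / (σ₁ + k - 1))) ^ 2 < ε / 8 := by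
    have h1 : Tendsto (fun T : ℝ ↦ T ^ (-(a * σ₁))) atTop (𝓝 0) :=
      tendsto_rpow_neg_atTop (by positivity)
    have h2 : Tendsto (fun T : ℝ ↦ (3 : ℝ) ^ k * T ^ (-e₀) / (σ₁ + k - 1)) atTop (𝓝 0) := by
      have h := ((tendsto_rpow_neg_atTop he₀0).const_mul ((3 : ℝ) ^ k)).div_const (σ₁ + k - 1)
      rw [mul_zero, zero_div] at h
      exact h
    have h := (((h1.add h2).const_mul C).pow 2).const_mul 6
    rw [add_zero, mul_zero, zero_pow two_ne_zero, mul_zero] at h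
    exact h.eventually_lt_const (by positivity)
  have eT : ∀ᶠ T : ℝ in atTop, max 4 (2 * (|σ₂| + k + 1)) ≤ T := eventually_ge_atTop _
  have eN : ∀ᶠ T : ℝ in atTop, 2 * T ≤ T ^ a := by
    have h1 : Tendsto (fun T : ℝ ↦ 2 * T ^ (-(a - 1))) atTop (𝓝 0) := by
      have h := (tendsto_rpow_neg_atTop (show 0 < a - 1 by linarith)).const_mul 2
      rwa [mul_zero] at h
    filter_upwards [h1.eventually_lt_const one_pos, eventually_ge_atTop (1 : ℝ)] with T hT hT1
    have hT0 : 0 < T := by linarith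
    have e : T ^ a = T ^ (a - 1) * T := by
      rw [← Real.rpow_add_one hT0.ne']; ring_nf
    have hinv : T ^ (-(a - 1)) = (T ^ (a - 1))⁻¹ := Real.rpow_neg hT0.le _
    rw [hinv] at hT
    have hpos : 0 < T ^ (a - 1) := Real.rpow_pos_of_pos hT0 _
    rw [mul_inv_lt_iff₀ hpos, one_mul] at hT
    rw [e]
    nlinarith
  obtain ⟨T₀, hT₀⟩ := eventually_atTop.1 (eT.and (eρ.and (eκ.and (eR.and eN))))
  refine ⟨T₀, fun T hT σ hσa hσb ↦ ?_⟩
  obtain ⟨hTmax, hρT, hκT, hRT, hNT⟩ := hT₀ T hT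
  clear hT₀ eT eρ eκ eR eN hMlim hP₀
  have hT4 : 4 ≤ T := (le_max_left _ _).trans hTmax
  have hTk : 2 * (|σ₂| + k + 1) ≤ T := (le_max_right _ _).trans hTmax
  have hT1 : 1 ≤ T := by linarith
  have hT0 : 0 < T := by linarith
  have hσ0 : 0 < σ := by linarith
  -- `N = ⌈T^a⌉ + 1 = M + 1`
  obtain ⟨M, hM⟩ : ∃ M : ℕ, M = ⌈T ^ a⌉₊ := ⟨_, rfl⟩
  set N : ℕ := M + 1 with hN_def
  have hρN : 6 * ρ N ^ 2 < ε / 8 := by rw [hN_def, hM]; exact hρT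
  clear hρT
  have hTa0 : 0 ≤ T ^ a := Real.rpow_nonneg hT0.le a
  have hTa2T : 2 * T ≤ T ^ a := hNT
  have hMa : T ^ a ≤ (M : ℝ) := by rw [hM]; exact Nat.le_ceil _
  have hMle : (M : ℝ) ≤ T ^ a + 1 := by rw [hM]; exact (Nat.ceil_lt_add_one hTa0).le
  have hN2 : (N : ℝ) ≤ 2 * T ^ a := by rw [hN_def]; push_cast; linarith
  have hM2T : 2 * T ≤ (M : ℝ) := hTa2T.trans hMa
  have hM1 : 1 ≤ M := by
    have : (1 : ℝ) ≤ M := by linarith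
    exact_mod_cast this
  have hM0 : (0 : ℝ) < M := by exact_mod_cast hM1
  have hN0 : (0 : ℝ) < N := by positivity
  have hsnorm : ∀ t ∈ Icc (-T) T, ‖(σ : ℂ) + t * I‖ ≤ |σ₂| + T := by
    intro t ht
    have hσabs : |σ| ≤ |σ₂| := by
      rw [abs_le]
      constructor <;> linarith [le_abs_self σ₂, neg_abs_le σ₂]
    calc ‖(σ : ℂ) + t * I‖ ≤ ‖(σ : ℂ)‖ + ‖(t : ℂ) * I‖ := norm_add_le _ _
      _ = |σ| + |t| := by
          rw [norm_mul, Complex.norm_I, mul_one, Complex.norm_real, Complex.norm_real,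
            Real.norm_eq_abs, Real.norm_eq_abs]
      _ ≤ |σ₂| + T := add_le_add hσabs (abs_le.2 ⟨by linarith [ht.1], ht.2⟩)
  -- real-number consequences
  have hNκ : (N : ℝ) ^ κ ≤ 2 * (T ^ (-(1 - a * κ)) * T) := by
    have e : T ^ (-(1 - a * κ)) * T = T ^ (a * κ) := by
      rw [← Real.rpow_add_one hT0.ne']; congr 1; ring
    rw [e]
    calc (N : ℝ) ^ κ ≤ (2 * T ^ a) ^ κ := Real.rpow_le_rpow hN0.le hN2 hκ0.le
      _ = 2 ^ κ * T ^ (a * κ) := by rw [Real.mul_rpow (by norm_num) hTa0, Real.rpow_mul hT0.le]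
      _ ≤ 2 * T ^ (a * κ) := by
          refine mul_le_mul_of_nonneg_right ?_ (Real.rpow_nonneg hT0.le _)
          calc (2 : ℝ) ^ κ ≤ 2 ^ (1 : ℝ) := Real.rpow_le_rpow_of_exponent_le (by norm_num) hκ1
            _ = 2 := Real.rpow_one 2
  -- the Abel remainder, pointwise
  set Rb : ℝ := C * (T ^ (-(a * σ₁)) + (3 : ℝ) ^ k * T ^ (-e₀) / (σ₁ + k - 1)) with hRb
  have hσk : 0 < σ₁ + k - 1 := by linarith
  have hRb0 : 0 ≤ Rb := by positivity
  have hR_pt : ∀ t ∈ Icc (-T) T, ‖χ.LFunction (σ + t * I) -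
      ∑ n ∈ Finset.range M, χ ((n + 1 : ℕ) : ZMod q) * ((n + 1 : ℕ) : ℂ) ^ (-(σ + t * I : ℂ))‖ ≤
        Rb := by
    intro t ht
    set s : ℂ := σ + t * I with hs_def
    have hsre : s.re = σ := by simp [hs_def]
    have hs0 : 0 < s.re := by rw [hsre]; exact hσ0
    have hsn : ‖s‖ ≤ |σ₂| + T := hsnorm t ht
    have hskM : ‖s‖ + k ≤ M := by linarith
    have h := norm_LFunction_sub_sum_le_iterated χ hχ hk1 hs0 hskM
    rw [hsre] at h
    refine h.trans ?_
    rw [hRb]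
    refine mul_le_mul_of_nonneg_left (add_le_add ?_ ?_) hC0
    · -- `M^{-σ} ≤ (T^a)^{-σ₁} = T^{-aσ₁}`
      calc (M : ℝ) ^ (-σ) ≤ (M : ℝ) ^ (-σ₁) :=
            Real.rpow_le_rpow_of_exponent_le (by linarith) (by linarith)
        _ ≤ (T ^ a) ^ (-σ₁) := Real.rpow_le_rpow_of_nonpos (by positivity) hMa (by linarith)
        _ = T ^ (-(a * σ₁)) := by rw [← Real.rpow_mul hT0.le]; congr 1; ring
    · -- `(‖s‖+k)^k M^{1-σ-k}/(σ+k-1) ≤ 3^k T^{-e₀}/(σ₁+k-1)`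
      have h3T : ‖s‖ + k ≤ 3 * T := by linarith [abs_nonneg σ₂]
      have hpow : (‖s‖ + k) ^ k ≤ (3 : ℝ) ^ k * T ^ (k : ℝ) := by
        rw [Real.rpow_natCast, ← mul_pow]
        exact pow_le_pow_left₀ (by positivity) h3T k
      have hexp : (M : ℝ) ^ (1 - σ - k) ≤ T ^ (a * (1 - σ₁ - k)) := by
        calc (M : ℝ) ^ (1 - σ - k) ≤ (M : ℝ) ^ (1 - σ₁ - k) :=
              Real.rpow_le_rpow_of_exponent_le (by linarith) (by linarith)
          _ ≤ (T ^ a) ^ (1 - σ₁ - k) :=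
              Real.rpow_le_rpow_of_nonpos (by positivity) hMa (by linarith)
          _ = T ^ (a * (1 - σ₁ - k)) := by rw [← Real.rpow_mul hT0.le]
      have hden : (σ₁ + k - 1)⁻¹ ≥ (σ + k - 1)⁻¹ := by
        rw [ge_iff_le, inv_le_inv₀ (by linarith) hσk]; linarith
      have hTe : T ^ (k : ℝ) * T ^ (a * (1 - σ₁ - k)) = T ^ (-e₀) := by
        rw [← Real.rpow_add hT0, he₀]; congr 1; ring
      calc (‖s‖ + k) ^ k * ((M : ℝ) ^ (1 - σ - k) / (σ + k - 1))
          = (‖s‖ + k) ^ k * (M : ℝ) ^ (1 - σ - k) * (σ + k - 1)⁻¹ := by rw [div_eq_mul_inv, mul_assoc]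
        _ ≤ ((3 : ℝ) ^ k * T ^ (k : ℝ)) * T ^ (a * (1 - σ₁ - k)) * (σ₁ + k - 1)⁻¹ := by
            refine mul_le_mul (mul_le_mul hpow hexp (by positivity) (by positivity)) hden
              (by rw [inv_nonneg]; linarith) (by positivity)
        _ = (3 : ℝ) ^ k * T ^ (-e₀) / (σ₁ + k - 1) := by
            rw [mul_assoc ((3 : ℝ) ^ k), hTe, div_eq_mul_inv]
  -- the functions of `t`
  obtain ⟨cD, hcD⟩ : ∃ cD : ℕ → ℂ, cD = (P.smoothNumbers)ᶜ.indicator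
      fun n : ℕ ↦ χ n * (n : ℂ) ^ (-(σ : ℂ)) := ⟨_, rfl⟩
  obtain ⟨D, hD⟩ : ∃ D : ℝ → ℂ, D = fun t : ℝ ↦
      ∑ n ∈ Finset.Icc 1 M, cD n * (n : ℂ) ^ (-((t : ℂ) * I)) := ⟨_, rfl⟩
  obtain ⟨Sm, hSm⟩ : ∃ Sm : ℝ → ℂ, Sm = fun t : ℝ ↦ ∑ n ∈ Finset.range N,
      (P.smoothNumbers).indicator (fun n : ℕ ↦ χ n * (n : ℂ) ^ (-(σ + t * I : ℂ))) n := ⟨_, rfl⟩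
  obtain ⟨S, hS⟩ : ∃ S : ℝ → ℂ, S = fun t : ℝ ↦ ∑ n ∈ Finset.range M,
      χ ((n + 1 : ℕ) : ZMod q) * ((n + 1 : ℕ) : ℂ) ^ (-(σ + t * I : ℂ)) := ⟨_, rfl⟩
  obtain ⟨Z, hZ⟩ : ∃ Z : ℝ → ℂ, Z = fun t : ℝ ↦
      ∏ p ∈ P.primesBelow, (1 - χ p * (p : ℂ) ^ (-(σ + t * I : ℂ)))⁻¹ := ⟨_, rfl⟩
  obtain ⟨R, hR⟩ : ∃ R : ℝ → ℂ, R = fun t : ℝ ↦ χ.LFunction (σ + t * I) - S t := ⟨_, rfl⟩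
  obtain ⟨Rs, hRs⟩ : ∃ Rs : ℝ → ℂ, Rs = fun t : ℝ ↦ Z t - Sm t := ⟨_, rfl⟩
  have hZt : ∀ t : ℝ, ∏ p ∈ P.primesBelow, (1 - χ p * (p : ℂ) ^ (-(σ + t * I : ℂ)))⁻¹ = Z t := by
    intro t; rw [hZ]
  simp_rw [hZt]
  -- the algebraic identity `L - Z = D + R - Rs`
  have hSSm : ∀ t : ℝ, S t - Sm t = D t := by
    intro t
    have h1 : Sm t = ∑ n ∈ Finset.Icc 1 M,
        (P.smoothNumbers).indicator (fun n : ℕ ↦ χ n * (n : ℂ) ^ (-(σ + t * I : ℂ))) n := by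
      rw [hSm]
      beta_reduce
      rw [Finset.range_eq_Ico, Finset.sum_eq_sum_Ico_succ_bot (Nat.succ_pos M),
        indicator_of_notMem (fun h ↦ Nat.ne_zero_of_mem_smoothNumbers h rfl), zero_add]
      rfl
    have h2 : S t = ∑ n ∈ Finset.Icc 1 M, χ (n : ZMod q) * (n : ℂ) ^ (-(σ + t * I : ℂ)) := by
      rw [hS]
      exact sum_range_succ_eq_sum_Icc (fun m : ℕ ↦ χ (m : ZMod q) * (m : ℂ) ^ (-(σ + t * I : ℂ))) M
    rw [h1, h2, hD]
    beta_reduce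
    rw [← Finset.sum_sub_distrib]
    refine Finset.sum_congr rfl fun n hn ↦ ?_
    rw [Finset.mem_Icc] at hn
    have hn0 : (n : ℂ) ≠ 0 := by exact_mod_cast (show n ≠ 0 by omega)
    have hsplit : (n : ℂ) ^ (-(σ + t * I : ℂ)) =
        (n : ℂ) ^ (-(σ : ℂ)) * (n : ℂ) ^ (-((t : ℂ) * I)) := by
      rw [← Complex.cpow_add _ _ hn0]; congr 1; ring
    by_cases hmem : n ∈ P.smoothNumbers
    · rw [indicator_of_mem hmem, hcD, indicator_of_notMem (Set.notMem_compl_iff.2 hmem), zero_mul,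
        sub_self]
    · rw [indicator_of_notMem hmem, hcD, indicator_of_mem (mem_compl hmem), sub_zero, hsplit,
        mul_assoc]
  have hident : ∀ t : ℝ, χ.LFunction (σ + t * I) - Z t = D t + R t - Rs t := by
    intro t; rw [← hSSm t, hR, hRs]; ring
  -- pointwise bounds on `[-T, T]`
  have hcD_norm : ∀ n : ℕ, ‖cD n‖ ^ 2 ≤
      (P.smoothNumbers)ᶜ.indicator (fun n : ℕ ↦ (n : ℝ) ^ (-(2 * σ₁))) n := by
    intro n
    by_cases hmem : n ∈ (P.smoothNumbers)ᶜ
    · rw [hcD, indicator_of_mem hmem, indicator_of_mem hmem]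
      rcases Nat.eq_zero_or_pos n with rfl | hn
      · have hne : (-(σ : ℂ)) ≠ 0 := by simpa using hσ0.ne'
        simp only [Nat.cast_zero]
        rw [Complex.zero_cpow hne, mul_zero, norm_zero, zero_pow two_ne_zero]
        exact Real.rpow_nonneg le_rfl _
      · have h1 : ‖χ n * (n : ℂ) ^ (-(σ : ℂ))‖ ≤ (n : ℝ) ^ (-σ) := by
          have := norm_char_mul_cpow_le χ hn (σ : ℂ)
          rwa [ofReal_re] at this
        have hn1 : (1 : ℝ) ≤ n := by exact_mod_cast hn
        calc ‖χ n * (n : ℂ) ^ (-(σ : ℂ))‖ ^ 2 ≤ ((n : ℝ) ^ (-σ)) ^ 2 :=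
              pow_le_pow_left₀ (norm_nonneg _) h1 2
          _ = (n : ℝ) ^ (-(2 * σ)) := by
              rw [← Real.rpow_natCast, ← Real.rpow_mul (Nat.cast_nonneg n)]; congr 1; push_cast; ring
          _ ≤ (n : ℝ) ^ (-(2 * σ₁)) := Real.rpow_le_rpow_of_exponent_le hn1 (by linarith)
    · rw [hcD, indicator_of_notMem hmem, indicator_of_notMem hmem, norm_zero, zero_pow two_ne_zero]
  have hR_bd : ∀ t ∈ Icc (-T) T, ‖R t‖ ≤ Rb := by
    intro t ht; rw [hR, hS]; exact hR_pt t ht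
  have hRs_bd : ∀ t : ℝ, ‖Rs t‖ ≤ ρ N := by
    intro t; rw [hRs, hZ, hSm]; exact hρbd N σ t hσa
  -- the majorant `g`
  obtain ⟨g, hg⟩ : ∃ g : ℝ → ℝ, g = fun t : ℝ ↦ 3 * ‖D t‖ ^ 2 + 3 * (Rb ^ 2 + ρ N ^ 2) :=
    ⟨_, rfl⟩
  have hfg : ∀ t ∈ Icc (-T) T, ‖χ.LFunction (σ + t * I) - Z t‖ ^ 2 ≤ g t := by
    intro t ht
    rw [hident t, hg]
    beta_reduce
    refine (norm_add_sub_sq_le _ _ _).trans ?_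
    have h2 : ‖R t‖ ^ 2 ≤ Rb ^ 2 := pow_le_pow_left₀ (norm_nonneg _) (hR_bd t ht) 2
    have h3 : ‖Rs t‖ ^ 2 ≤ ρ N ^ 2 := pow_le_pow_left₀ (norm_nonneg _) (hRs_bd t) 2
    linarith only [h2, h3]
  -- continuity
  have hDcont : Continuous D := by
    rw [hD]
    refine continuous_finsetSum _ fun n hn ↦ continuous_const.mul ?_
    rw [Finset.mem_Icc] at hn
    have : (fun t : ℝ ↦ (n : ℂ) ^ (-((t : ℂ) * I))) =
        fun t : ℝ ↦ Complex.exp ((-(t * Real.log n) : ℝ) * I) := by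
      funext t; exact natCast_cpow_neg_mul_I (by omega) t
    rw [this]; fun_prop
  have hgcont : Continuous g := by
    rw [hg]
    exact (continuous_const.mul ((continuous_norm.comp hDcont).pow 2)).add continuous_const
  have hLZcont : Continuous fun t : ℝ ↦ ‖χ.LFunction (σ + t * I) - Z t‖ ^ 2 := by
    rw [hZ]
    exact (continuous_norm.comp (continuous_LFunction_sub_eulerProduct χ hχ hσ0 P)).pow 2
  -- integrate: `∫_{-T}^{T} |L - Z|² ≤ ∫_{-T}^{T} g`
  have hTT : -T ≤ T := by linarith
  have hint_g : IntervalIntegrable g volume (-T) T := hgcont.intervalIntegrable _ _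
  have hstep1 : ∫ t in (-T : ℝ)..T, ‖χ.LFunction (σ + t * I) - Z t‖ ^ 2 ≤
      ∫ t in (-T : ℝ)..T, g t :=
    intervalIntegral.integral_mono_on hTT (hLZcont.intervalIntegrable _ _) hint_g
      fun t ht ↦ hfg t ht
  -- the mean square of the Dirichlet polynomial `D`
  have hD_meanSq : ∫ t in (-T : ℝ)..T, ‖D t‖ ^ 2 ≤
      5 * T * ∑' n : ℕ, ((n + P : ℕ) : ℝ) ^ (-(2 * σ₁)) + 65 * ((N : ℝ) ^ κ / κ) := by
    have hMVT := DirichletMVT.meanSquare_le_sharp cD M hT4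
    rw [hD]
    refine hMVT.trans ?_
    have hsplit : ∑ n ∈ Finset.Icc 1 M, (5 * T + 65 * n) * ‖cD n‖ ^ 2 =
        5 * T * ∑ n ∈ Finset.Icc 1 M, ‖cD n‖ ^ 2 +
          65 * ∑ n ∈ Finset.Icc 1 M, n * ‖cD n‖ ^ 2 := by
      rw [Finset.mul_sum, Finset.mul_sum, ← Finset.sum_add_distrib]
      refine Finset.sum_congr rfl fun n _ ↦ by ring
    rw [hsplit]
    -- the diagonal: non-smooth `n` are `≥ P`
    have hdiag : ∑ n ∈ Finset.Icc 1 M, ‖cD n‖ ^ 2 ≤ ∑' n : ℕ, ((n + P : ℕ) : ℝ) ^ (-(2 * σ₁)) := by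
      have h1 : ∑ n ∈ Finset.Icc 1 M, ‖cD n‖ ^ 2 ≤ ∑ n ∈ Finset.Icc 1 M,
          (P.smoothNumbers)ᶜ.indicator (fun n : ℕ ↦ (n : ℝ) ^ (-(2 * σ₁))) n :=
        Finset.sum_le_sum fun n _ ↦ hcD_norm n
      have h2 : ∑ n ∈ Finset.Icc 1 M,
          (P.smoothNumbers)ᶜ.indicator (fun n : ℕ ↦ (n : ℝ) ^ (-(2 * σ₁))) n ≤
            ∑ n ∈ Finset.Ico P N, (n : ℝ) ^ (-(2 * σ₁)) := by
        rw [← Finset.sum_filter_add_sum_filter_not (Finset.Icc 1 M)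
            (fun n ↦ n ∈ (P.smoothNumbers)ᶜ),
          Finset.sum_congr rfl (fun n hn ↦ indicator_of_mem (Finset.mem_filter.1 hn).2 _),
          Finset.sum_congr rfl (fun n hn ↦ indicator_of_notMem (Finset.mem_filter.1 hn).2 _),
          Finset.sum_const_zero, add_zero]
        refine Finset.sum_le_sum_of_subset_of_nonneg (fun n hn ↦ ?_) fun n _ _ ↦ by positivity
        rw [Finset.mem_filter, Finset.mem_Icc] at hn
        rw [Finset.mem_Ico]
        exact ⟨le_of_not_mem_smoothNumbers hn.1.1 hn.2, by omega⟩
      exact h1.trans (h2.trans (sum_Ico_rpow_le_tsum hσ₁ P N))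
    -- the off-diagonal: `Σ n · n^{-2σ₁} ≤ Σ n^{κ-1} ≤ M^κ/κ ≤ N^κ/κ`
    have hoff : ∑ n ∈ Finset.Icc 1 M, (n : ℝ) * ‖cD n‖ ^ 2 ≤ (N : ℝ) ^ κ / κ := by
      have h1 : ∑ n ∈ Finset.Icc 1 M, (n : ℝ) * ‖cD n‖ ^ 2 ≤
          ∑ n ∈ Finset.Icc 1 M, (n : ℝ) ^ (κ - 1) := by
        refine Finset.sum_le_sum fun n hn ↦ ?_
        rw [Finset.mem_Icc] at hn
        have hn1 : (1 : ℝ) ≤ n := Nat.one_le_cast.2 hn.1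
        have hn0 : (0 : ℝ) < n := lt_of_lt_of_le zero_lt_one hn1
        have h3 : ‖cD n‖ ^ 2 ≤ (n : ℝ) ^ (-(2 * σ₁)) := by
          refine (hcD_norm n).trans ?_
          by_cases hmem : n ∈ (P.smoothNumbers)ᶜ
          · rw [indicator_of_mem hmem]
          · rw [indicator_of_notMem hmem]; positivity
        calc (n : ℝ) * ‖cD n‖ ^ 2 ≤ n * (n : ℝ) ^ (-(2 * σ₁)) :=
              mul_le_mul_of_nonneg_left h3 hn0.le
          _ = (n : ℝ) ^ (1 - 2 * σ₁) := by
              rw [show (1 : ℝ) - 2 * σ₁ = 1 + (-(2 * σ₁)) by ring, Real.rpow_add hn0,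
                Real.rpow_one]
          _ ≤ (n : ℝ) ^ (κ - 1) :=
              Real.rpow_le_rpow_of_exponent_le hn1 (by linarith only [hκ₀κ, hκ₀])
      have h2 : (M : ℝ) ^ κ / κ ≤ (N : ℝ) ^ κ / κ := by
        have hMN : (M : ℝ) ≤ N := by exact_mod_cast Nat.le_succ M
        exact div_le_div_of_nonneg_right (Real.rpow_le_rpow (Nat.cast_nonneg M) hMN hκ0.le)
          hκ0.le
      exact h1.trans ((sum_Icc_rpow_sub_one_le hκ0 hκ1 M).trans h2)
    exact add_le_add (mul_le_mul_of_nonneg_left hdiag (by positivity))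
      (mul_le_mul_of_nonneg_left hoff (by norm_num))
  -- the integral of the majorant
  have hg_int : ∫ t in (-T : ℝ)..T, g t ≤
      3 * (5 * T * ∑' n : ℕ, ((n + P : ℕ) : ℝ) ^ (-(2 * σ₁)) + 65 * ((N : ℝ) ^ κ / κ)) +
        (T - -T) * (3 * (Rb ^ 2 + ρ N ^ 2)) := by
    have hi1 : IntervalIntegrable (fun t : ℝ ↦ 3 * ‖D t‖ ^ 2) volume (-T) T :=
      ((continuous_const.mul ((continuous_norm.comp hDcont).pow 2)).intervalIntegrable _ _)
    have hi3 : IntervalIntegrable (fun _ : ℝ ↦ 3 * (Rb ^ 2 + ρ N ^ 2)) volume (-T) T :=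
      intervalIntegrable_const
    rw [hg, intervalIntegral.integral_add hi1 hi3, intervalIntegral.integral_const,
      intervalIntegral.integral_const_mul, smul_eq_mul]
    have h3 : (0 : ℝ) ≤ 3 := by norm_num
    exact add_le_add (mul_le_mul_of_nonneg_left hD_meanSq h3) (le_of_eq (by ring))
  -- conclusion
  have hbook := bookkeeping (A := (N : ℝ) ^ κ) (X := T ^ (-(1 - a * κ))) hT1 hκ0 hτ0 hτ hNκ hκT
    hRT hρN
  exact hstep1.trans (hg_int.trans hbook)

end CharEulerProductMeanSquare

end Literature.NumberTheory.LFunctions
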